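import Mathlib
import Literature.NumberTheory.Transcendental.AssociatorsRegularisation
import Literature.NumberTheory.Transcendental.MZVShuffleRegularisation
import Literature.NumberTheory.Transcendental.AssociatorsPairing
import HarnessLib

/-!
# Shuffle regularisation over a general alphabet and the factorisation of group-like series

Second proofs file towards `drinfeldAssociator_pentagon` (`DrinfeldAssociator.lean`,
[Drinfeld1991, (2.13)]): the pure algebra behind the explicit formula
`Φ_KZ = 1 + Σ_W (-1)^{dp W} Z(reg W) W` [Furusho2003, Prop. 3.2.3] = [LeMurakami1996, Thm A.9],
[IharaKanekoZagier2006, §3, Cor. 5]. Everything is proved; no named fact is introduced.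

For an alphabet `α` with two distinguished letters `x` (bad at the END of a word: `dt/t`, singular at
the lower limit) and `y` (bad at the FRONT: `dt/(t-1)`, singular at the upper limit) — and any
number of further "neutral" letters, needed for the perturbed KZ equations along the edges of the
pentagon cell — we set up the shuffle algebra `ℚ⟨α⟩ = List α →₀ ℚ` (`Shuffle.wordSum`,
`Shuffle.shuffleSum`, generalising verbatim the tree's `MZV.wordSum`, `MZV.shuffleSum` on `Bool`) and:

1. the **end recursion** `(Ua) ш (Vb) = (U ш Vb)a + (Ua ш V)b` (`Shuffle.shuffleSum_append_singleton`)
   and reversal symmetry `ũ ш ṽ = (u ш v)~` (`Shuffle.shuffleSum_reverse`);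
2. **IKZ's Corollary 5**: the front regularisation
   `regFront y w = Σ_{i ≤ m} (-1)^i yⁱ ш (drop i w)` (`m` = number of leading `y`'s) has NO word
   starting with `y` (`Shuffle.regFront_apply_cons_self`; proof: deleting a leading `y` is a
   `ш`-derivation and the sum telescopes), the mirror `regEnd x` (via reversal) and the two-sided
   `Shuffle.reg x y` = `regFront y ∘ regEnd x`; on `Bool` these ARE `MZV.regFront/regEnd/shuffleReg`
   (`Shuffle.reg_false_true_eq_shuffleReg`), and `reg x y W` is supported on CONVERGENT words
   (not starting with `y`, not ending with `x`; `Shuffle.support_reg_subset`);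
3. **shuffle characters** = group-like series `χ` (`NCSeries.IsGroupLike`): if `χ(y) = 0` then
   `⟨χ, regFront y w⟩ = χ(w)` (`Shuffle.pair_regFront`; `χ` kills all `yⁱ` as `y ш yⁱ = (i+1)y^{i+1}`),
   likewise `pair_regEnd`, `pair_reg`;
4. `Shuffle.expLetter c ℓ = exp(ℓ c)` is group-like (`isGroupLike_expLetter`), the product of
   group-like series is group-like (`NCSeries.IsGroupLike.mul` of `AssociatorsPairing.lean`; the
   underlying bialgebra identity is also recorded here as `sum_shuffleWord_sum_splits`), and
   `expLetter c ℓ = NCSeries.exp (monomial [c] ℓ)` (`expLetter_eq_exp`);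
5. **the factorisation** (`Shuffle.factorisation`): for a group-like `S` and `x ≠ y`,
   `exp(-S(y)·y) · S · exp(-S(x)·x) = Σ_W ⟨S, reg x y W⟩ W`,
   with the one-sided versions `mul_expLetter_eq_pair_regEnd`, `expLetter_mul_eq_pair_regFront`.
   For `S` = the transport of `A dt/t + B dt/(t-1)` over `[ε, 1-δ]` (group-like by
   `isGroupLike_transportSeries` of `DrinfeldAssociatorTransport.lean`; `S(x) = log((1-δ)/ε)`,
   `S(y) = log(δ/(1-ε))`) this is `(1-ε)^{B} δ^{-B} · T(1-δ←ε) · ε^{A} (1-δ)^{-A} = Σ_W T(reg W) W`,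
   the exact form of [Furusho2003, Prop. 3.2.3] / [LeMurakami1996, (A.15)] before letting `ε, δ → 0`.

## References

* K. Ihara, M. Kaneko, D. Zagier, *Derivation and double shuffle relations for multiple zeta
  values*, Compos. Math. 142 (2006), §3 (`reg_ш`), Cor. 5 p. 322. [IharaKanekoZagier2006]
* H. Furusho, Publ. RIMS 39 (2003), §3.2 Prop. 3.2.3 (arXiv:math/0011261 p. 10, Prop. 4.2.3).
  [Furusho2003]
* T. Q. T. Le, J. Murakami, Nagoya Math. J. 142 (1996), Thm A.9, (A.15). [LeMurakami1996]
* C. Reutenauer, *Free Lie algebras* (1993), §1.4–1.5 (shuffle bialgebra, characters), §6.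
  [Reutenauer1993]
-/

noncomputable section

open Finsupp Finset
open scoped BigOperators

namespace Literature.NumberTheory.Transcendental

namespace Shuffle

universe u
variable {α : Type u}


/-! ## 1. The generic shuffle algebra `ℚ⟨α⟩ = List α →₀ ℚ` -/

/-- The element `Σ_{w ∈ L} w` of `ℚ⟨α⟩ = List α →₀ ℚ` for a list of words with multiplicity
(verbatim `MZV.wordSum` over a general alphabet). [cite: IharaKanekoZagier2006, §1] -/
def wordSum (L : List (List α)) : List α →₀ ℚ := (L.map fun w => Finsupp.single w (1 : ℚ)).sum

/-- `wordSum [] = 0`. [folklore] -/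
@[simp] theorem wordSum_nil : wordSum ([] : List (List α)) = 0 := rfl

/-- `wordSum (w :: L) = w + wordSum L`. [folklore] -/
@[simp] theorem wordSum_cons (w : List α) (L : List (List α)) :
    wordSum (w :: L) = Finsupp.single w 1 + wordSum L := by
  simp [wordSum]

/-- `wordSum (L ++ L') = wordSum L + wordSum L'`. [folklore] -/
theorem wordSum_append (L L' : List (List α)) : wordSum (L ++ L') = wordSum L + wordSum L' := by
  simp [wordSum, List.sum_append]

/-- Relabelling the words of a list is `mapDomain` on its sum. [folklore] -/
theorem wordSum_map {β : Type*} (g : List α → List β) (L : List (List α)) :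
    (wordSum (α := α) L).mapDomain g = ((L.map g).map fun w => Finsupp.single w (1 : ℚ)).sum := by
  induction L with
  | nil => simp [wordSum, Finsupp.mapDomain_zero]
  | cons w L ih =>
    rw [wordSum_cons, Finsupp.mapDomain_add, Finsupp.mapDomain_single, ih]
    simp

/-- Relabelling the words of a list is `mapDomain` on its sum (same alphabet). [folklore] -/
theorem wordSum_map' (g : List α → List α) (L : List (List α)) :
    wordSum (L.map g) = (wordSum L).mapDomain g := by
  rw [wordSum_map]; rfl

/-- The pairing `⟨χ, F⟩ = Σ_v F_v χ(v)` of a function on words (a series) with an element of `ℚ⟨α⟩`.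
[folklore] -/
def pair {K : Type*} [AddCommMonoid K] [Module ℚ K] (χ : List α → K) (F : List α →₀ ℚ) : K :=
  F.sum fun v a => a • χ v

/-- `⟨χ, a·v⟩ = a χ(v)`. [folklore] -/
theorem pair_single {K : Type*} [AddCommMonoid K] [Module ℚ K] (χ : List α → K) (v : List α)
    (a : ℚ) : pair χ (Finsupp.single v a) = a • χ v := by
  simp [pair, Finsupp.sum_single_index]

/-- The pairing is additive. [folklore] -/
theorem pair_add {K : Type*} [AddCommMonoid K] [Module ℚ K] (χ : List α → K)
    (F G : List α →₀ ℚ) : pair χ (F + G) = pair χ F + pair χ G :=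
  Finsupp.sum_add_index' (by simp) (by intros; simp [add_smul])

/-- `⟨χ, 0⟩ = 0`. [folklore] -/
theorem pair_zero {K : Type*} [AddCommMonoid K] [Module ℚ K] (χ : List α → K) :
    pair χ (0 : List α →₀ ℚ) = 0 := by simp [pair]

/-- The pairing is `ℚ`-linear. [folklore] -/
theorem pair_smul {K : Type*} [AddCommMonoid K] [Module ℚ K] (χ : List α → K) (c : ℚ)
    (F : List α →₀ ℚ) : pair χ (c • F) = c • pair χ F := by
  simp only [pair]
  rw [Finsupp.sum_smul_index' (by simp)]
  simp only [Finsupp.sum, Finset.smul_sum, smul_smul, smul_eq_mul]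

/-- The pairing commutes with finite sums. [folklore] -/
theorem pair_sum {K : Type*} [AddCommMonoid K] [Module ℚ K] (χ : List α → K) {ι : Type*}
    (s : Finset ι) (F : ι → List α →₀ ℚ) : pair χ (∑ i ∈ s, F i) = ∑ i ∈ s, pair χ (F i) := by
  classical
  induction s using Finset.induction_on with
  | empty => simp [pair_zero]
  | insert i s hi ih => rw [Finset.sum_insert hi, Finset.sum_insert hi, pair_add, ih]

/-- `⟨χ, Σ_{w∈L} w⟩ = Σ_{w∈L} χ(w)`. [folklore] -/
theorem pair_wordSum {K : Type*} [AddCommMonoid K] [Module ℚ K] (χ : List α → K)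
    (L : List (List α)) : pair χ (wordSum L) = (L.map χ).sum := by
  induction L with
  | nil => simp [pair_zero]
  | cons w L ih => rw [wordSum_cons, pair_add, pair_single, one_smul, ih, List.map_cons, List.sum_cons]

/-- `⟨χ, g_* F⟩ = ⟨χ ∘ g, F⟩`. [folklore] -/
theorem pair_mapDomain {K : Type*} [AddCommMonoid K] [Module ℚ K] (χ : List α → K)
    (g : List α → List α) (F : List α →₀ ℚ) : pair χ (F.mapDomain g) = pair (χ ∘ g) F := by
  simp only [pair]
  rw [Finsupp.sum_mapDomain_index (by simp) (by intros; simp [add_smul])]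
  rfl

/-- The shuffle product `u ш v ∈ ℚ⟨α⟩` of two words, `MZV.shuffleWord` summed with multiplicity
(verbatim `MZV.shuffleSum`). [cite: IharaKanekoZagier2006, §1 (ш)] -/
def shuffleSum (u v : List α) : List α →₀ ℚ := wordSum (MZV.shuffleWord u v)

/-- `[] ш v = v`. [folklore] -/
@[simp] theorem shuffleSum_nil_left (v : List α) : shuffleSum [] v = Finsupp.single v 1 := by
  simp [shuffleSum]

/-- `u ш [] = u`. [folklore] -/
@[simp] theorem shuffleSum_nil_right (u : List α) : shuffleSum u [] = Finsupp.single u 1 := by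
  simp [shuffleSum]

/-- The front recursion `(a u) ш (b v) = a (u ш b v) + b (a u ш v)`. [cite: Reutenauer1993, §1.4] -/
theorem shuffleSum_cons_cons (a b : α) (u v : List α) :
    shuffleSum (a :: u) (b :: v) =
      (shuffleSum u (b :: v)).mapDomain (List.cons a) +
        (shuffleSum (a :: u) v).mapDomain (List.cons b) := by
  simp only [shuffleSum, MZV.shuffleWord_cons_cons, wordSum_append, wordSum_map']

/-- `⟨χ, u ш v⟩ = Σ_{w ∈ u ш v} χ(w)`. [folklore] -/
theorem pair_shuffleSum {K : Type*} [AddCommMonoid K] [Module ℚ K] (χ : List α → K)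
    (u v : List α) : pair χ (shuffleSum u v) = ((MZV.shuffleWord u v).map χ).sum :=
  pair_wordSum χ _

/-- Composition of two relabellings. [folklore] -/
theorem mapDomain_comp' (g h : List α → List α) (F : List α →₀ ℚ) :
    (F.mapDomain g).mapDomain h = F.mapDomain (h ∘ g) := (Finsupp.mapDomain_comp).symm

/-- `[a] ш (V b) = (V b a) + ([a] ш V) b`. [folklore] -/
theorem shuffleSum_singleton_append_singleton (a b : α) (V : List α) :
    shuffleSum [a] (V ++ [b]) =
      Finsupp.single (V ++ [b] ++ [a]) 1 + (shuffleSum [a] V).mapDomain (· ++ [b]) := by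
  induction V with
  | nil =>
    simp only [List.nil_append, shuffleSum_nil_right, Finsupp.mapDomain_single]
    rw [shuffleSum_cons_cons, shuffleSum_nil_left, shuffleSum_nil_right, Finsupp.mapDomain_single,
      Finsupp.mapDomain_single, add_comm]
    simp
  | cons d V ih =>
    rw [List.cons_append, shuffleSum_cons_cons, shuffleSum_nil_left, Finsupp.mapDomain_single, ih,
      Finsupp.mapDomain_add, Finsupp.mapDomain_single, shuffleSum_cons_cons, shuffleSum_nil_left,
      Finsupp.mapDomain_single, Finsupp.mapDomain_add, Finsupp.mapDomain_single, mapDomain_comp',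
      mapDomain_comp']
    have : (fun x => x ++ [b]) ∘ List.cons d = List.cons d ∘ fun x => x ++ [b] := by
      funext x; rfl
    rw [this]
    simp only [List.cons_append, List.append_assoc]
    abel

/-- `(U a) ш [b] = (U ш [b]) a + (U a b)`. [folklore] -/
theorem shuffleSum_append_singleton_singleton (a b : α) (U : List α) :
    shuffleSum (U ++ [a]) [b] =
      (shuffleSum U [b]).mapDomain (· ++ [a]) + Finsupp.single (U ++ [a] ++ [b]) 1 := by
  induction U with
  | nil =>
    simp only [List.nil_append, shuffleSum_nil_left, Finsupp.mapDomain_single]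
    rw [shuffleSum_cons_cons, shuffleSum_nil_left, shuffleSum_nil_right, Finsupp.mapDomain_single,
      Finsupp.mapDomain_single, add_comm]
    simp
  | cons c U ih =>
    rw [List.cons_append, shuffleSum_cons_cons, shuffleSum_nil_right, Finsupp.mapDomain_single, ih,
      Finsupp.mapDomain_add, Finsupp.mapDomain_single, shuffleSum_cons_cons, shuffleSum_nil_right,
      Finsupp.mapDomain_single, Finsupp.mapDomain_add, Finsupp.mapDomain_single, mapDomain_comp',
      mapDomain_comp']
    have : (fun x => x ++ [a]) ∘ List.cons c = List.cons c ∘ fun x => x ++ [a] := by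
      funext x; rfl
    rw [this]
    simp only [List.cons_append, List.append_assoc]
    abel

/-- **End recursion of the shuffle product**: `(U a) ш (V b) = (U ш V b) a + (U a ш V) b`. [cite:
Reutenauer1993, §1.4] -/
theorem shuffleSum_append_singleton :
    ∀ (U V : List α) (a b : α), shuffleSum (U ++ [a]) (V ++ [b]) =
      (shuffleSum U (V ++ [b])).mapDomain (· ++ [a]) +
        (shuffleSum (U ++ [a]) V).mapDomain (· ++ [b])
  | [], V, a, b => by
    rw [List.nil_append, shuffleSum_singleton_append_singleton, shuffleSum_nil_left,
      Finsupp.mapDomain_single]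
  | c :: U, [], a, b => by
    rw [List.nil_append, shuffleSum_append_singleton_singleton,
      shuffleSum_nil_right, Finsupp.mapDomain_single]
  | c :: U, d :: V, a, b => by
    have h1 := shuffleSum_append_singleton U (d :: V) a b
    have h2 := shuffleSum_append_singleton (c :: U) V a b
    rw [List.cons_append] at h1
    rw [List.cons_append] at h2
    rw [List.cons_append, List.cons_append, shuffleSum_cons_cons, h1, h2, shuffleSum_cons_cons,
      shuffleSum_cons_cons]
    simp only [Finsupp.mapDomain_add, mapDomain_comp']
    have e1 : (fun x => x ++ [a]) ∘ List.cons c = List.cons c ∘ fun x => x ++ [a] := by funext; rfl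
    have e2 : (fun x => x ++ [b]) ∘ List.cons c = List.cons c ∘ fun x => x ++ [b] := by funext; rfl
    have e3 : (fun x => x ++ [a]) ∘ List.cons d = List.cons d ∘ fun x => x ++ [a] := by funext; rfl
    have e4 : (fun x => x ++ [b]) ∘ List.cons d = List.cons d ∘ fun x => x ++ [b] := by funext; rfl
    rw [e1, e2, e3, e4]
    abel

/-- **The shuffle product commutes with word reversal**: `ũ ш ṽ = (u ш v)~`. [cite: Reutenauer1993,
§1.4] -/
theorem shuffleSum_reverse :
    ∀ (u v : List α), shuffleSum u.reverse v.reverse = (shuffleSum u v).mapDomain List.reverse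
  | [], v => by simp
  | c :: u, [] => by simp
  | c :: u, d :: v => by
    rw [List.reverse_cons, List.reverse_cons, shuffleSum_append_singleton, ← List.reverse_cons,
      ← List.reverse_cons, shuffleSum_reverse u (d :: v), shuffleSum_reverse (c :: u) v,
      shuffleSum_cons_cons, Finsupp.mapDomain_add, mapDomain_comp', mapDomain_comp',
      mapDomain_comp', mapDomain_comp']
    have e1 : (fun x => x ++ [c]) ∘ List.reverse = List.reverse ∘ List.cons c := by
      funext x; simp
    have e2 : (fun x => x ++ [d]) ∘ List.reverse = List.reverse ∘ List.cons d := by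
      funext x; simp
    rw [e1, e2]

/-! ## 2. Coefficient extraction and supports -/

section Coeff
variable [DecidableEq α]

/-- Coefficient of `d v` in `c · F` (prefixing by a letter). [folklore] -/
theorem mapDomain_cons_apply_cons (F : List α →₀ ℚ) (c d : α) (v : List α) :
    (F.mapDomain (List.cons c)) (d :: v) = if c = d then F v else 0 := by
  split_ifs with h
  · subst h
    exact Finsupp.mapDomain_apply (List.cons_injective) F v
  · exact Finsupp.mapDomain_notin_range F _ (by rintro ⟨u, hu⟩; exact h (List.cons.inj hu).1)

omit [DecidableEq α] in
/-- Prefixed elements have no constant term. [folklore] -/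
theorem mapDomain_cons_apply_nil (F : List α →₀ ℚ) (c : α) :
    (F.mapDomain (List.cons c)) [] = 0 :=
  Finsupp.mapDomain_notin_range F _ (by rintro ⟨u, hu⟩; exact List.cons_ne_nil _ _ hu)

/-- Front-deletion coefficient of a shuffle: `(cu ш dv)_{yw} = [c=y](u ш dv)_w + [d=y](cu ш v)_w` —
deleting the first letter is a derivation of `ш`. [folklore] -/
theorem shuffleSum_cons_cons_apply_cons (c d y : α) (u v w : List α) :
    shuffleSum (c :: u) (d :: v) (y :: w) =
      (if c = y then shuffleSum u (d :: v) w else 0) + (if d = y then shuffleSum (c :: u) v w else 0) := by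
  rw [shuffleSum_cons_cons, Finsupp.add_apply, mapDomain_cons_apply_cons, mapDomain_cons_apply_cons]

/-- A word in the support of `wordSum L` occurs in `L`. [folklore] -/
theorem mem_of_mem_support_wordSum {L : List (List α)} {w : List α} (h : w ∈ (wordSum L).support) :
    w ∈ L := by
  induction L with
  | nil => simp at h
  | cons v L ih =>
    rw [wordSum_cons] at h
    have := Finsupp.support_add h
    rw [Finset.mem_union] at this
    rcases this with h1 | h1
    · have := Finsupp.support_single_subset h1
      rw [Finset.mem_singleton] at this
      simp [this]
    · exact List.mem_cons_of_mem _ (ih h1)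

/-- A word in the support of `u ш v` is one of the listed shuffles. [folklore] -/
theorem mem_shuffleWord_of_mem_support {u v w : List α} (h : w ∈ (shuffleSum u v).support) :
    w ∈ MZV.shuffleWord u v :=
  mem_of_mem_support_wordSum h

end Coeff

/-! ## 3. Front regularisation and IKZ's Corollary 5 -/

section Front
variable [DecidableEq α]

/-- The number `m` of leading letters `y` of a word (`w = y^m w'`, `w'` not starting with `y`;
`MZV.leadingY` for `y = true`). [cite: IharaKanekoZagier2006, Cor. 5] -/
def leadCount (y : α) (w : List α) : ℕ := (w.takeWhile fun b => decide (b = y)).length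

/-- `leadCount y [] = 0`. [folklore] -/
@[simp] theorem leadCount_nil (y : α) : leadCount y ([] : List α) = 0 := rfl

/-- `leadCount y (y w) = leadCount y w + 1`. [folklore] -/
theorem leadCount_cons_self (y : α) (w : List α) : leadCount y (y :: w) = leadCount y w + 1 := by
  simp [leadCount]

/-- A word not starting with `y` has no leading `y`. [folklore] -/
theorem leadCount_cons_of_ne {y c : α} (h : c ≠ y) (w : List α) : leadCount y (c :: w) = 0 := by
  simp [leadCount, h]

/-- `w = y^m (drop m w)`, `m = leadCount y w`. [folklore] -/
theorem replicate_leadCount_append_drop (y : α) :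
    ∀ w : List α, List.replicate (leadCount y w) y ++ w.drop (leadCount y w) = w
  | [] => rfl
  | c :: w => by
    by_cases h : c = y
    · subst h
      rw [leadCount_cons_self, List.replicate_succ, List.cons_append, List.drop_succ_cons,
        replicate_leadCount_append_drop]
    · rw [leadCount_cons_of_ne h]; rfl

/-- `drop m w` does not start with `y`. [folklore] -/
theorem drop_leadCount_head_ne (y : α) :
    ∀ w : List α, (w.drop (leadCount y w)).head? ≠ some y
  | [] => by simp
  | c :: w => by
    by_cases h : c = y
    · subst h
      rw [leadCount_cons_self, List.drop_succ_cons]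
      exact drop_leadCount_head_ne _ w
    · rw [leadCount_cons_of_ne h]
      simpa using h

/-- For `i < m`, `drop i w = y (drop (i+1) w)`. [folklore] -/
theorem drop_lt_leadCount (y : α) (w : List α) {i : ℕ} (hi : i < leadCount y w) :
    w.drop i = y :: w.drop (i + 1) := by
  have h := replicate_leadCount_append_drop y w
  set m := leadCount y w
  have hlen : i < (List.replicate m y).length := by simpa using hi
  conv_lhs => rw [← h]
  conv_rhs => rw [← h]
  rw [List.drop_append_of_le_length hlen.le, List.drop_append_of_le_length (by simpa using hi),
    List.drop_replicate, List.drop_replicate]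
  obtain ⟨k, hk⟩ : ∃ k, m - i = k + 1 := ⟨m - i - 1, by omega⟩
  rw [hk, show m - (i + 1) = k by omega, List.replicate_succ, List.cons_append]

/-- `drop m w` is empty or starts with a letter `≠ y`. [folklore] -/
theorem drop_leadCount_eq_nil_or (y : α) (w : List α) :
    w.drop (leadCount y w) = [] ∨ ∃ c v, c ≠ y ∧ w.drop (leadCount y w) = c :: v := by
  rcases h : w.drop (leadCount y w) with _ | ⟨c, v⟩
  · exact Or.inl rfl
  · refine Or.inr ⟨c, v, fun hc => ?_, rfl⟩
    have := drop_leadCount_head_ne y w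
    rw [h, hc] at this
    exact this rfl

/-- **IKZ's regularisation formula at the front** (Cor. 5 with `T = 0`) for the letter `y`:
`regFront y w = Σ_{i=0}^{m} (-1)^i yⁱ ш (drop i w)`, `m = leadCount y w` (`MZV.regFront` for `y =
true`). [cite: IharaKanekoZagier2006, Cor. 5 p. 322] -/
def regFront (y : α) (w : List α) : List α →₀ ℚ :=
  ∑ i ∈ range (leadCount y w + 1), ((-1 : ℚ) ^ i) • shuffleSum (List.replicate i y) (w.drop i)

/-- Front deletion of `y^{i+1} ш z` for `z` not starting with `y`. [folklore] -/
theorem shuffleSum_replicate_succ_apply_cons_of_head_ne (y : α) (i : ℕ) {z : List α}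
    (hz : z.head? ≠ some y) (w : List α) :
    shuffleSum (List.replicate (i + 1) y) z (y :: w) = shuffleSum (List.replicate i y) z w := by
  rcases z with _ | ⟨c, v⟩
  · rw [shuffleSum_nil_right, shuffleSum_nil_right, List.replicate_succ, Finsupp.single_apply,
      Finsupp.single_apply]
    simp
  · have hc : c ≠ y := by simpa using hz
    rw [List.replicate_succ, shuffleSum_cons_cons_apply_cons, if_pos rfl, if_neg hc, add_zero]

/-- Front deletion of `y^{i+1} ш (y z)`. [folklore] -/
theorem shuffleSum_replicate_succ_apply_cons_cons (y : α) (i : ℕ) (z w : List α) :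
    shuffleSum (List.replicate (i + 1) y) (y :: z) (y :: w) =
      shuffleSum (List.replicate i y) (y :: z) w + shuffleSum (List.replicate (i + 1) y) z w := by
  rw [List.replicate_succ, shuffleSum_cons_cons_apply_cons, if_pos rfl, if_pos rfl]

/-- **`regFront y w` has no word starting with `y`** — the content of IKZ Cor. 5 (the formula
computes the constant term of `𝔥 = 𝔥'[y]`): the front deletion of the sum telescopes. [cite:
IharaKanekoZagier2006, Cor. 5] -/
theorem regFront_apply_cons_self (y : α) (w v : List α) : regFront y w (y :: v) = 0 := by
  set m := leadCount y w with hm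
  -- `T i := (y^i ш drop i w)_{ ... }` pieces
  have key : ∀ i, i ≤ m → shuffleSum (List.replicate i y) (w.drop i) (y :: v) =
      (if 1 ≤ i then shuffleSum (List.replicate (i - 1) y) (w.drop i) v else 0) +
        (if i < m then shuffleSum (List.replicate i y) (w.drop (i + 1)) v else 0) := by
    intro i hi
    rcases Nat.lt_or_ge i m with hlt | hge
    · rw [if_pos hlt, drop_lt_leadCount y w hlt]
      rcases i with _ | i
      · simp only [List.replicate_zero, shuffleSum_nil_left, zero_add]
        rw [Finsupp.single_apply, Finsupp.single_apply]
        simp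
      · rw [if_pos (by omega), shuffleSum_replicate_succ_apply_cons_cons, Nat.add_sub_cancel,
          ← drop_lt_leadCount y w hlt]
    · have hi' : i = m := le_antisymm hi hge
      have hdrop : (w.drop i).head? ≠ some y := by
        rw [hi', hm]; exact drop_leadCount_head_ne y w
      rw [if_neg (show ¬ i < m by omega), add_zero]
      rcases i with _ | i
      · simp only [Nat.le_zero, one_ne_zero, if_false, List.replicate_zero, shuffleSum_nil_left]
        rw [Finsupp.single_apply, if_neg]
        intro h
        rw [h] at hdrop
        exact hdrop rfl
      · rw [if_pos (by omega), Nat.add_sub_cancel,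
          shuffleSum_replicate_succ_apply_cons_of_head_ne y i hdrop]
  unfold regFront
  rw [← hm, Finsupp.finsetSum_apply]
  simp only [Finsupp.smul_apply, smul_eq_mul]
  rw [Finset.sum_congr rfl fun i hi => by rw [key i (Nat.lt_succ_iff.mp (Finset.mem_range.mp hi))]]
  simp only [mul_add, Finset.sum_add_distrib]
  -- first sum: shift index
  rw [Finset.sum_range_succ' (fun i => (-1 : ℚ) ^ i * if 1 ≤ i then _ else 0)]
  simp only [Nat.le_zero, one_ne_zero, if_false, mul_zero, add_zero, le_add_iff_nonneg_left,
    zero_le, if_true, Nat.add_sub_cancel]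
  rw [Finset.sum_range_succ (fun i => (-1 : ℚ) ^ i * if i < m then _ else 0), if_neg (lt_irrefl _),
    mul_zero, add_zero, ← Finset.sum_add_distrib]
  refine Finset.sum_eq_zero fun i hi => ?_
  rw [Finset.mem_range] at hi
  rw [if_pos hi, pow_succ]
  ring

/-- Words in the support of `regFront y w` do not start with `y`. [cite: IharaKanekoZagier2006, Cor.
5] -/
theorem head_ne_of_mem_support_regFront (y : α) (w : List α) {u : List α}
    (hu : u ∈ (regFront y w).support) : u.head? ≠ some y := by
  intro h
  rcases u with _ | ⟨c, v⟩
  · simp at h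
  · simp only [List.head?_cons, Option.some.injEq] at h
    subst h
    exact (Finsupp.mem_support_iff.mp hu) (regFront_apply_cons_self c w v)

/-- Words in the support of `regFront y w` are shuffles of some `yⁱ` with `drop i w`. [folklore] -/
theorem exists_of_mem_support_regFront (y : α) (w : List α) {u : List α}
    (hu : u ∈ (regFront y w).support) :
    ∃ i ≤ leadCount y w, u ∈ MZV.shuffleWord (List.replicate i y) (w.drop i) := by
  unfold regFront at hu
  obtain ⟨i, hi, hiu⟩ := Finset.mem_biUnion.mp (Finsupp.support_finsetSum hu)
  refine ⟨i, Nat.lt_succ_iff.mp (Finset.mem_range.mp hi), mem_shuffleWord_of_mem_support ?_⟩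
  exact Finsupp.support_smul hiu

/-- The last letter of a word in the support of `regFront y w` is `y` or the last letter of `w` (or
the word is empty). [folklore] -/
theorem getLast?_of_mem_support_regFront (y : α) (w : List α) {u : List α}
    (hu : u ∈ (regFront y w).support) :
    u = [] ∨ u.getLast? = some y ∨ u.getLast? = w.getLast? := by
  obtain ⟨i, hi, hmem⟩ := exists_of_mem_support_regFront y w hu
  rcases u.eq_nil_or_concat with rfl | ⟨u', c, rfl⟩
  · exact Or.inl rfl
  · right
    have h := MZV.getLast?_of_mem_shuffleWord _ _ hmem
    rcases h with h | h
    · left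
      rw [h]
      cases i with
      | zero => simp at h
      | succ i => simp [List.getLast?_replicate]
    · right
      rw [h, List.getLast?_drop]
      split_ifs with hlt
      · exfalso
        rw [List.concat_eq_append, List.getLast?_append] at h
        simp at h
        have : w.drop i = [] := List.drop_eq_nil_of_le (by omega)
        rw [List.getLast?_drop, if_pos hlt] at h
        exact absurd h (by simp)
      · rfl

end Front

/-! ## 4. Shuffle characters (group-like series) and the regularisations -/

section Char
variable [DecidableEq α] {K : Type*} [CommRing K] [Algebra ℚ K]

omit [DecidableEq α] in
/-- For a group-like series (a shuffle character), `⟨χ, u ш v⟩ = χ(u) χ(v)`. [cite: Reutenauer1993,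
§1.5] -/
theorem pair_shuffleSum_of_isGroupLike {χ : NCSeries α K} (hχ : NCSeries.IsGroupLike χ)
    (u v : List α) : pair χ (shuffleSum u v) = χ u * χ v := by
  rw [pair_shuffleSum, hχ.2 u v]

omit [DecidableEq α] in
/-- `y ш yⁱ = (i+1) y^{i+1}`. [folklore] -/
theorem shuffleSum_singleton_replicate (y : α) :
    ∀ i : ℕ, shuffleSum [y] (List.replicate i y) =
      ((i : ℚ) + 1) • Finsupp.single (List.replicate (i + 1) y) 1
  | 0 => by simp
  | i + 1 => by
    rw [List.replicate_succ, shuffleSum_cons_cons, shuffleSum_nil_left, Finsupp.mapDomain_single,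
      shuffleSum_singleton_replicate y i, Finsupp.mapDomain_smul, Finsupp.mapDomain_single]
    rw [← List.replicate_succ, ← List.replicate_succ, Nat.cast_succ, add_smul, add_smul, one_smul,
      add_smul, one_smul]
    abel

omit [DecidableEq α] in
/-- In a `ℚ`-module, `(n+1) • x = 0` forces `x = 0`. [folklore] -/
theorem eq_zero_of_nat_succ_smul {M : Type*} [AddCommGroup M] [Module ℚ M] (i : ℕ) {x : M}
    (h : ((i : ℚ) + 1) • x = 0) : x = 0 := by
  have hne : ((i : ℚ) + 1) ≠ 0 := by positivity
  rw [← inv_smul_smul₀ hne x, h, smul_zero]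

omit [DecidableEq α] in
/-- A group-like series vanishing on the letter `y` vanishes on all powers `y^{i+1}`. [folklore] -/
theorem apply_replicate_succ_eq_zero {χ : NCSeries α K} (hχ : NCSeries.IsGroupLike χ) {y : α}
    (hy : χ [y] = 0) : ∀ i : ℕ, χ (List.replicate (i + 1) y) = 0
  | 0 => by simpa using hy
  | i + 1 => by
    have h := pair_shuffleSum_of_isGroupLike hχ [y] (List.replicate (i + 1) y)
    rw [hy, zero_mul, shuffleSum_singleton_replicate, pair_smul, pair_single, one_smul] at h
    exact eq_zero_of_nat_succ_smul (i + 1) h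

/-- **`⟨χ, regFront y w⟩ = χ(w)`** for a group-like `χ` with `χ(y) = 0` (a shuffle character killing
`y` factors through the front regularisation). [cite: IharaKanekoZagier2006, §3 (reg_ш as the
ш-homomorphism killing y)] -/
theorem pair_regFront {χ : NCSeries α K} (hχ : NCSeries.IsGroupLike χ) {y : α} (hy : χ [y] = 0)
    (w : List α) : pair χ (regFront y w) = χ w := by
  unfold regFront
  rw [pair_sum, Finset.sum_range_succ', Finset.sum_eq_zero]
  · simp [pair_single]
  · intro i _
    rw [pair_smul, pair_shuffleSum_of_isGroupLike hχ, apply_replicate_succ_eq_zero hχ hy i, zero_mul,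
      smul_zero]

omit [DecidableEq α] in
/-- The reversed series `w ↦ χ(w̃)` of a group-like series is group-like. [folklore] -/
theorem isGroupLike_reverse {χ : NCSeries α K} (hχ : NCSeries.IsGroupLike χ) :
    NCSeries.IsGroupLike (fun w => χ w.reverse : NCSeries α K) := by
  refine ⟨by simpa using hχ.1, fun u v => ?_⟩
  have h1 : ((MZV.shuffleWord u v).map (fun w => χ w.reverse : NCSeries α K)).sum =
      pair (χ ∘ List.reverse) (shuffleSum u v) := (pair_shuffleSum _ u v).symm
  rw [h1, ← pair_mapDomain, ← shuffleSum_reverse, pair_shuffleSum_of_isGroupLike hχ]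

/-- **The end regularisation** for the letter `x`, mirror image of `regFront` under word reversal:
`regEnd x w = Σ_{k=0}^{n} (-1)^k xᵏ ш (w minus its last k letters)` (`MZV.regEnd` for `x = false`).
[cite: IharaKanekoZagier2006, Cor. 5 (mirror image)] -/
def regEnd (x : α) (w : List α) : List α →₀ ℚ := (regFront x w.reverse).mapDomain List.reverse

/-- **`⟨χ, regEnd x w⟩ = χ(w)`** for a group-like `χ` with `χ(x) = 0`. [cite: IharaKanekoZagier2006,
§3] -/
theorem pair_regEnd {χ : NCSeries α K} (hχ : NCSeries.IsGroupLike χ) {x : α} (hx : χ [x] = 0)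
    (w : List α) : pair χ (regEnd x w) = χ w := by
  rw [regEnd, pair_mapDomain]
  have h := pair_regFront (isGroupLike_reverse hχ) (y := x) (by simpa using hx) w.reverse
  simpa [Function.comp_def] using h

/-- Words in the support of `regEnd x w` do not end with `x`. [folklore] -/
theorem getLast?_ne_of_mem_support_regEnd (x : α) (w : List α) {u : List α}
    (hu : u ∈ (regEnd x w).support) : u.getLast? ≠ some x := by
  rw [regEnd, Finsupp.mapDomain_support_of_injective List.reverse_injective, Finset.mem_image] at hu
  obtain ⟨v, hv, rfl⟩ := hu
  rw [List.getLast?_reverse]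
  exact head_ne_of_mem_support_regFront x _ hv

/-- Words in the support of `regEnd x w` are empty, start with `x`, or start like `w`. [folklore] -/
theorem head?_of_mem_support_regEnd (x : α) (w : List α) {u : List α}
    (hu : u ∈ (regEnd x w).support) : u = [] ∨ u.head? = some x ∨ u.head? = w.head? := by
  rw [regEnd, Finsupp.mapDomain_support_of_injective List.reverse_injective, Finset.mem_image] at hu
  obtain ⟨v, hv, rfl⟩ := hu
  rcases getLast?_of_mem_support_regFront x _ hv with h | h | h
  · left; simp [h]
  · right; left; simpa using h
  · right; right; simpa [List.getLast?_reverse] using h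

/-- **The two-sided shuffle regularisation** `reg : ℚ⟨α⟩ → 𝔥⁰` (front letter `y`, end letter `x`):
`regFront y` applied linearly to `regEnd x w` (`MZV.shuffleReg` on `Bool`). [cite:
IharaKanekoZagier2006, §3 p. 314 (reg_ш) with Cor. 5] -/
def reg (x y : α) (w : List α) : List α →₀ ℚ := (regEnd x w).sum fun u a => a • regFront y u

/-- **`⟨χ, reg x y w⟩ = χ(w)`** for a group-like `χ` with `χ(x) = χ(y) = 0`: a shuffle character
killing the two letters factors through the regularisation. [cite: IharaKanekoZagier2006, §3] -/
theorem pair_reg {χ : NCSeries α K} (hχ : NCSeries.IsGroupLike χ) {x y : α} (hx : χ [x] = 0)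
    (hy : χ [y] = 0) (w : List α) : pair χ (reg x y w) = χ w := by
  rw [reg, ← pair_regEnd hχ hx w]
  conv_rhs => rw [pair]
  simp only [Finsupp.sum]
  rw [pair_sum]
  refine Finset.sum_congr rfl fun u _ => ?_
  rw [pair_smul, pair_regFront hχ hy]

/-- Words in the support of `reg x y w` do not start with `y` … [folklore] -/
theorem head?_ne_of_mem_support_reg (x y : α) (w : List α) {v : List α}
    (hv : v ∈ (reg x y w).support) : v.head? ≠ some y := by
  rw [reg] at hv
  simp only [Finsupp.sum] at hv
  obtain ⟨u, _, huv⟩ := Finset.mem_biUnion.mp (Finsupp.support_finsetSum hv)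
  exact head_ne_of_mem_support_regFront y u (Finsupp.support_smul huv)

/-- … and do not end with `x` (when `x ≠ y`). [folklore] -/
theorem getLast?_ne_of_mem_support_reg {x y : α} (hxy : x ≠ y) (w : List α) {v : List α}
    (hv : v ∈ (reg x y w).support) : v.getLast? ≠ some x := by
  rw [reg] at hv
  simp only [Finsupp.sum] at hv
  obtain ⟨u, hu, huv⟩ := Finset.mem_biUnion.mp (Finsupp.support_finsetSum hv)
  have hu' := getLast?_ne_of_mem_support_regEnd x w hu
  rcases getLast?_of_mem_support_regFront y u (Finsupp.support_smul huv) with h | h | h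
  · simp [h]
  · rw [h]; simpa using Ne.symm hxy
  · rwa [h]

end Char

/-! ## 5. Exponentials of letters and products of group-like series -/

section ExpLetter
variable [DecidableEq α] {K : Type*} [CommRing K] [Algebra ℚ K]

omit [DecidableEq α] in
/-- Letters of a shuffle come from the two shuffled words. [folklore] -/
theorem mem_or_mem_of_mem_shuffleWord :
    ∀ (u v : List α) {w : List α}, w ∈ MZV.shuffleWord u v → ∀ a ∈ w, a ∈ u ∨ a ∈ v
  | [], v, w, hw, a, ha => by simp at hw; subst hw; exact Or.inr ha
  | c :: u, [], w, hw, a, ha => by simp at hw; subst hw; exact Or.inl ha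
  | c :: u, d :: v, w, hw, a, ha => by
    rw [MZV.shuffleWord_cons_cons, List.mem_append, List.mem_map, List.mem_map] at hw
    rcases hw with ⟨w', hw', rfl⟩ | ⟨w', hw', rfl⟩
    · rcases List.mem_cons.mp ha with rfl | ha
      · exact Or.inl List.mem_cons_self
      · rcases mem_or_mem_of_mem_shuffleWord u (d :: v) hw' a ha with h | h
        · exact Or.inl (List.mem_cons_of_mem _ h)
        · exact Or.inr h
    · rcases List.mem_cons.mp ha with rfl | ha
      · exact Or.inr List.mem_cons_self
      · rcases mem_or_mem_of_mem_shuffleWord (c :: u) v hw' a ha with h | h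
        · exact Or.inl h
        · exact Or.inr (List.mem_cons_of_mem _ h)

omit [DecidableEq α] in
/-- Letters of the shuffled words occur in every shuffle. [folklore] -/
theorem mem_of_mem_shuffleWord_of_mem :
    ∀ (u v : List α) {w : List α}, w ∈ MZV.shuffleWord u v → ∀ a, (a ∈ u ∨ a ∈ v) → a ∈ w
  | [], v, w, hw, a, ha => by simp at hw; subst hw; simpa using ha
  | c :: u, [], w, hw, a, ha => by simp at hw; subst hw; simpa using ha
  | c :: u, d :: v, w, hw, a, ha => by
    rw [MZV.shuffleWord_cons_cons, List.mem_append, List.mem_map, List.mem_map] at hw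
    rcases hw with ⟨w', hw', rfl⟩ | ⟨w', hw', rfl⟩
    · rcases ha with ha | ha
      · rcases List.mem_cons.mp ha with rfl | ha
        · exact List.mem_cons_self
        · exact List.mem_cons_of_mem _ (mem_of_mem_shuffleWord_of_mem u _ hw' a (Or.inl ha))
      · exact List.mem_cons_of_mem _ (mem_of_mem_shuffleWord_of_mem u _ hw' a (Or.inr ha))
    · rcases ha with ha | ha
      · exact List.mem_cons_of_mem _ (mem_of_mem_shuffleWord_of_mem _ v hw' a (Or.inl ha))
      · rcases List.mem_cons.mp ha with rfl | ha
        · exact List.mem_cons_self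
        · exact List.mem_cons_of_mem _ (mem_of_mem_shuffleWord_of_mem _ v hw' a (Or.inr ha))

/-- **The exponential of a letter** `exp(ℓ · c) = Σ_n (ℓⁿ/n!) cⁿ` as a series (see
`expLetter_eq_exp`). [folklore] -/
def expLetter (c : α) (ℓ : K) : NCSeries α K := fun w =>
  if w = List.replicate w.length c then algebraMap ℚ K (1 / (w.length.factorial : ℚ)) * ℓ ^ w.length
  else 0

/-- `exp(ℓ c)` has constant term `1`. [folklore] -/
@[simp] theorem expLetter_nil (c : α) (ℓ : K) : expLetter c ℓ [] = 1 := by simp [expLetter]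

/-- Coefficient `ℓⁿ/n!` of `cⁿ` in `exp(ℓ c)`. [folklore] -/
theorem expLetter_replicate (c : α) (ℓ : K) (n : ℕ) :
    expLetter c ℓ (List.replicate n c) = algebraMap ℚ K (1 / (n.factorial : ℚ)) * ℓ ^ n := by
  simp [expLetter]

/-- Coefficient `ℓ` of `c` in `exp(ℓ c)`. [folklore] -/
@[simp] theorem expLetter_singleton_self (c : α) (ℓ : K) : expLetter c ℓ [c] = ℓ := by
  rw [show [c] = List.replicate 1 c from rfl, expLetter_replicate]; simp

/-- `exp(ℓ c)` vanishes on words containing another letter. [folklore] -/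
theorem expLetter_eq_zero_of_mem (c : α) (ℓ : K) {w : List α} {a : α} (ha : a ∈ w) (hac : a ≠ c) :
    expLetter c ℓ w = 0 := by
  unfold expLetter
  rw [if_neg]
  intro h
  rw [h] at ha
  exact hac (List.eq_of_mem_replicate ha)

/-- `exp(ℓ c)` vanishes on other letters. [folklore] -/
theorem expLetter_singleton_of_ne (c : α) (ℓ : K) {a : α} (hac : a ≠ c) : expLetter c ℓ [a] = 0 :=
  expLetter_eq_zero_of_mem c ℓ (List.mem_singleton_self a) hac

/-- **`exp(ℓ · c)` is group-like** (`c` is primitive; `cᵐ ш cⁿ = C(m+n,m) c^{m+n}`). [cite: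
Reutenauer1993, Thm 3.2] -/
theorem isGroupLike_expLetter (c : α) (ℓ : K) : NCSeries.IsGroupLike (expLetter c ℓ) := by
  refine ⟨expLetter_nil c ℓ, fun u v => ?_⟩
  by_cases hu : ∃ a ∈ u, a ≠ c
  · obtain ⟨a, hau, hac⟩ := hu
    rw [expLetter_eq_zero_of_mem c ℓ hau hac, zero_mul, eq_comm]
    refine List.sum_eq_zero fun x hx => ?_
    obtain ⟨w, hw, rfl⟩ := List.mem_map.mp hx
    exact expLetter_eq_zero_of_mem c ℓ (mem_of_mem_shuffleWord_of_mem u v hw a (Or.inl hau)) hac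
  by_cases hv : ∃ a ∈ v, a ≠ c
  · obtain ⟨a, hav, hac⟩ := hv
    rw [expLetter_eq_zero_of_mem c ℓ hav hac, mul_zero, eq_comm]
    refine List.sum_eq_zero fun x hx => ?_
    obtain ⟨w, hw, rfl⟩ := List.mem_map.mp hx
    exact expLetter_eq_zero_of_mem c ℓ (mem_of_mem_shuffleWord_of_mem u v hw a (Or.inr hav)) hac
  push Not at hu hv
  have hu' : u = List.replicate u.length c := List.eq_replicate_iff.mpr ⟨rfl, hu⟩
  have hv' : v = List.replicate v.length c := List.eq_replicate_iff.mpr ⟨rfl, hv⟩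
  set m := u.length
  set n := v.length
  have hall : ∀ w ∈ MZV.shuffleWord u v, expLetter c ℓ w =
      algebraMap ℚ K (1 / ((m + n).factorial : ℚ)) * ℓ ^ (m + n) := by
    intro w hw
    have hlen := MZV.length_of_mem_shuffleWord u v hw
    have hw' : w = List.replicate (m + n) c := by
      refine List.eq_replicate_iff.mpr ⟨hlen, fun b hb => ?_⟩
      rcases mem_or_mem_of_mem_shuffleWord u v hw b hb with h | h
      · exact hu b h
      · exact hv b h
    rw [hw', expLetter_replicate]
  rw [List.map_congr_left hall, List.map_const', List.sum_replicate, MZV.length_shuffleWord,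
    hu', hv', expLetter_replicate, expLetter_replicate, List.length_replicate, List.length_replicate,
    nsmul_eq_mul]
  have h := Nat.add_choose_mul_factorial_mul_factorial m n
  have hm : (m.factorial : ℚ) ≠ 0 := by positivity
  have hn : (n.factorial : ℚ) ≠ 0 := by positivity
  have hmn : ((m + n).factorial : ℚ) ≠ 0 := by positivity
  have h' : ((m + n).factorial : ℚ) = m.factorial * n.factorial * (m + n).choose m := by
    exact_mod_cast (by rw [← h, Nat.choose_symm_add]; ring :
      (m + n).factorial = m.factorial * n.factorial * (m + n).choose m)
  have hq : (1 / (m.factorial : ℚ)) * (1 / (n.factorial : ℚ)) =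
      ((m + n).choose m : ℚ) * (1 / ((m + n).factorial : ℚ)) := by
    field_simp
    exact h'
  calc algebraMap ℚ K (1 / (m.factorial : ℚ)) * ℓ ^ m * (algebraMap ℚ K (1 / (n.factorial : ℚ)) * ℓ ^ n)
      = algebraMap ℚ K ((1 / (m.factorial : ℚ)) * (1 / (n.factorial : ℚ))) * ℓ ^ (m + n) := by
        rw [map_mul, pow_add]; ring
    _ = algebraMap ℚ K (((m + n).choose m : ℚ) * (1 / ((m + n).factorial : ℚ))) * ℓ ^ (m + n) := by
        rw [hq]
    _ = ((m + n).choose m : K) * (algebraMap ℚ K (1 / ((m + n).factorial : ℚ)) * ℓ ^ (m + n)) := by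
        rw [map_mul, map_natCast]; ring

omit [DecidableEq α] [Algebra ℚ K] in
/-- **Deconcatenations of shuffles are shuffles of deconcatenations** — the bialgebra axiom `Δ(u ш
v) = Δ(u) ш Δ(v)` for the deconcatenation coproduct, transposed and summed against an arbitrary `G`.
[cite: Reutenauer1993, §1.5] -/
theorem sum_shuffleWord_sum_splits :
    ∀ (u v : List α) (G : List α → List α → K),
      ((MZV.shuffleWord u v).map fun w => ∑ r ∈ NCSeries.splits w, G r.1 r.2).sum =
        ∑ p ∈ NCSeries.splits u, ∑ q ∈ NCSeries.splits v,
          ((MZV.shuffleWord p.1 q.1).map fun a => ((MZV.shuffleWord p.2 q.2).map (G a)).sum).sum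
  | [], v, G => by
    simp [NCSeries.splits, Finset.sum_map]
  | c :: u, [], G => by
    simp [NCSeries.splits, Finset.sum_map]
  | c :: u, d :: v, G => by
    -- left-hand side
    rw [MZV.shuffleWord_cons_cons, List.map_append, List.sum_append, List.map_map, List.map_map]
    have hL1 : ((MZV.shuffleWord u (d :: v)).map
        ((fun w => ∑ r ∈ NCSeries.splits w, G r.1 r.2) ∘ List.cons c)).sum =
        ((MZV.shuffleWord u (d :: v)).map fun w => G [] (c :: w)).sum +
          ((MZV.shuffleWord u (d :: v)).map fun w => ∑ r ∈ NCSeries.splits w, G (c :: r.1) r.2).sum := by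
      rw [← List.sum_map_add]
      refine congrArg _ (List.map_congr_left fun w _ => ?_)
      simp only [Function.comp_apply]
      rw [NCSeries.sum_splits_cons]
    have hL2 : ((MZV.shuffleWord (c :: u) v).map
        ((fun w => ∑ r ∈ NCSeries.splits w, G r.1 r.2) ∘ List.cons d)).sum =
        ((MZV.shuffleWord (c :: u) v).map fun w => G [] (d :: w)).sum +
          ((MZV.shuffleWord (c :: u) v).map fun w => ∑ r ∈ NCSeries.splits w, G (d :: r.1) r.2).sum := by
      rw [← List.sum_map_add]
      refine congrArg _ (List.map_congr_left fun w _ => ?_)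
      simp only [Function.comp_apply]
      rw [NCSeries.sum_splits_cons]
    rw [hL1, hL2, sum_shuffleWord_sum_splits u (d :: v) (fun a b => G (c :: a) b),
      sum_shuffleWord_sum_splits (c :: u) v (fun a b => G (d :: a) b)]
    -- the `A₁ + A₂` term
    have hA : ((MZV.shuffleWord (c :: u) (d :: v)).map (G [])).sum =
        ((MZV.shuffleWord u (d :: v)).map fun w => G [] (c :: w)).sum +
          ((MZV.shuffleWord (c :: u) v).map fun w => G [] (d :: w)).sum := by
      rw [MZV.shuffleWord_cons_cons, List.map_append, List.sum_append, List.map_map, List.map_map]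
      rfl
    -- the `R₂₂ + R₂₃` term
    have hB : ∀ p : List α × List α, ∀ q : List α × List α,
        ((MZV.shuffleWord (c :: p.1) (d :: q.1)).map fun a =>
            ((MZV.shuffleWord p.2 q.2).map (G a)).sum).sum =
          ((MZV.shuffleWord p.1 (d :: q.1)).map fun a =>
              ((MZV.shuffleWord p.2 q.2).map (G (c :: a))).sum).sum +
            ((MZV.shuffleWord (c :: p.1) q.1).map fun a =>
              ((MZV.shuffleWord p.2 q.2).map (G (d :: a))).sum).sum := by
      intro p q
      rw [MZV.shuffleWord_cons_cons, List.map_append, List.sum_append, List.map_map, List.map_map]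
      rfl
    -- expand all sums over `splits (c :: u)` and `splits (d :: v)`
    simp only [NCSeries.sum_splits_cons c u, NCSeries.sum_splits_cons d v, MZV.shuffleWord_nil_left,
      MZV.shuffleWord_nil_right, List.map_singleton, List.sum_singleton, hB, Finset.sum_add_distrib]
    rw [hA]
    abel

end ExpLetter

/-! ## 6. The factorisation of a group-like series through the regularisation -/

section Factorisation
variable [DecidableEq α] {K : Type*} [CommRing K] [Algebra ℚ K]

omit [DecidableEq α] [Algebra ℚ K] in
/-- Coefficient of a product at a single letter: `(PQ)_a = P_∅ Q_a + P_a Q_∅`. [folklore] -/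
theorem mul_apply_singleton (P Q : NCSeries α K) (a : α) :
    (P * Q) [a] = P [] * Q [a] + P [a] * Q [] := by
  rw [NCSeries.mul_apply, NCSeries.sum_splits_cons]
  simp [NCSeries.splits]

/-- Left multiplication by `exp(ℓ y)` does not change the coefficients of words not starting with
`y`. [folklore] -/
theorem expLetter_mul_apply_of_head_ne (y : α) (ℓ : K) (X : NCSeries α K) {W : List α}
    (hW : W.head? ≠ some y) : (expLetter y ℓ * X) W = X W := by
  rw [NCSeries.mul_apply, ← Finset.add_sum_erase _ _ (NCSeries.nil_self_mem_splits W), expLetter_nil,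
    one_mul, Finset.sum_eq_zero, add_zero]
  intro p hp
  obtain ⟨hne, hp⟩ := Finset.mem_erase.mp hp
  rw [NCSeries.mem_splits] at hp
  rcases h1 : p.1 with _ | ⟨c, u⟩
  · exfalso; apply hne; ext1; exact h1; simpa [h1] using hp
  · have hc : c ≠ y := by
      intro hcy
      apply hW
      rw [← hp, h1, hcy]; rfl
    rw [expLetter_eq_zero_of_mem y ℓ (List.mem_cons_self) hc, zero_mul]

/-- Right multiplication by `exp(ℓ x)` does not change the coefficients of words not ending with
`x`. [folklore] -/
theorem mul_expLetter_apply_of_getLast?_ne (x : α) (ℓ : K) (X : NCSeries α K) {W : List α}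
    (hW : W.getLast? ≠ some x) : (X * expLetter x ℓ) W = X W := by
  rw [NCSeries.mul_apply, ← Finset.add_sum_erase _ _ (NCSeries.self_nil_mem_splits W), expLetter_nil,
    mul_one, Finset.sum_eq_zero, add_zero]
  intro p hp
  obtain ⟨hne, hp⟩ := Finset.mem_erase.mp hp
  rw [NCSeries.mem_splits] at hp
  rcases p.2.eq_nil_or_concat with h2 | ⟨u, c, h2⟩
  · exfalso; apply hne; ext1
    · simpa [h2] using hp
    · exact h2
  · have hc : c ≠ x := by
      intro hcx
      apply hW
      rw [← hp, h2, hcx, List.concat_eq_append, ← List.append_assoc, List.getLast?_append]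
      rfl
    rw [expLetter_eq_zero_of_mem x ℓ (by rw [h2]; simp) hc, mul_zero]

omit [DecidableEq α] in
/-- Congruence of the pairing on the support. [folklore] -/
theorem pair_congr {χ χ' : List α → K} {F : List α →₀ ℚ} (h : ∀ v ∈ F.support, χ v = χ' v) :
    pair χ F = pair χ' F :=
  Finsupp.sum_congr fun v hv => by rw [h v hv]

/-- **End factorisation** of a group-like series: `S · exp(-S(x) x) = Σ_W ⟨S, regEnd x W⟩ W`. [cite:
Furusho2003, Prop. 3.2.3 (method of LeMurakami1996 (A.15))] -/
theorem mul_expLetter_eq_pair_regEnd {S : NCSeries α K} (hS : NCSeries.IsGroupLike S) (x : α)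
    (W : List α) : (S * expLetter x (-S [x])) W = pair S (regEnd x W) := by
  set L := S * expLetter x (-S [x]) with hL
  have hLg : NCSeries.IsGroupLike L := hS.mul (isGroupLike_expLetter x _)
  have hLx : L [x] = 0 := by
    rw [hL, mul_apply_singleton, hS.1, expLetter_singleton_self, expLetter_nil]; ring
  rw [← pair_regEnd hLg hLx W]
  refine pair_congr fun v hv => ?_
  exact mul_expLetter_apply_of_getLast?_ne x _ S (getLast?_ne_of_mem_support_regEnd x W hv)

/-- **Front factorisation** of a group-like series: `exp(-S(y) y) · S = Σ_W ⟨S, regFront y W⟩ W`.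
[cite: Furusho2003, Prop. 3.2.3 (method of LeMurakami1996 (A.15))] -/
theorem expLetter_mul_eq_pair_regFront {S : NCSeries α K} (hS : NCSeries.IsGroupLike S) (y : α)
    (W : List α) : (expLetter y (-S [y]) * S) W = pair S (regFront y W) := by
  set L := expLetter y (-S [y]) * S with hL
  have hLg : NCSeries.IsGroupLike L := (isGroupLike_expLetter y _).mul hS
  have hLy : L [y] = 0 := by
    rw [hL, mul_apply_singleton, hS.1, expLetter_singleton_self, expLetter_nil]; ring
  rw [← pair_regFront hLg hLy W]
  refine pair_congr fun v hv => ?_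
  exact expLetter_mul_apply_of_head_ne y _ S (head_ne_of_mem_support_regFront y W hv)

/-- **Two-sided factorisation** (Le–Murakami / Furusho / IKZ): for a group-like `S` and letters `x ≠
y`, `exp(-S(y) y) · S · exp(-S(x) x) = Σ_W ⟨S, reg x y W⟩ W`. Applied to the transport series of the
KZ equation on `[ε, 1-δ]` it exhibits `δ^{-B} T ε^{A}`, up to factors tending to `1`, as the series
of regularised iterated integrals. [cite: Furusho2003, Prop. 3.2.3] -/
theorem factorisation {S : NCSeries α K} (hS : NCSeries.IsGroupLike S) {x y : α} (hxy : x ≠ y)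
    (W : List α) : (expLetter y (-S [y]) * S * expLetter x (-S [x])) W = pair S (reg x y W) := by
  set L := expLetter y (-S [y]) * S * expLetter x (-S [x]) with hL
  have hLg : NCSeries.IsGroupLike L :=
    ((isGroupLike_expLetter y _).mul hS).mul (isGroupLike_expLetter x _)
  have hconv : ∀ v : List α, v.head? ≠ some y → v.getLast? ≠ some x → L v = S v := by
    intro v h1 h2
    rw [hL, mul_expLetter_apply_of_getLast?_ne x _ _ h2, expLetter_mul_apply_of_head_ne y _ _ h1]
  have hLx : L [x] = 0 := by
    rw [hL, mul_apply_singleton, expLetter_mul_apply_of_head_ne y _ _ (W := []) (by simp),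
      expLetter_mul_apply_of_head_ne y _ _ (W := [x]) (by simpa using hxy), hS.1,
      expLetter_singleton_self, expLetter_nil]
    ring
  have hLy : L [y] = 0 := by
    rw [hL, mul_expLetter_apply_of_getLast?_ne x _ _ (W := [y]) (by simpa using Ne.symm hxy),
      mul_apply_singleton, hS.1, expLetter_singleton_self, expLetter_nil]
    ring
  rw [← pair_reg hLg hLx hLy W]
  refine pair_congr fun v hv => hconv v ?_ ?_
  · exact head?_ne_of_mem_support_reg x y W hv
  · exact getLast?_ne_of_mem_support_reg hxy W hv

/-- The support of `reg x y W` consists of words not starting with `y` and not ending with `x` (the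
CONVERGENT words for `x = dt/t`, `y = dt/(t-1)`). [cite: IharaKanekoZagier2006, §3 (reg_ш : 𝔥 → 𝔥⁰)]
-/
theorem support_reg_subset {x y : α} (hxy : x ≠ y) (W : List α) {v : List α}
    (hv : v ∈ (reg x y W).support) : v.head? ≠ some y ∧ v.getLast? ≠ some x :=
  ⟨head?_ne_of_mem_support_reg x y W hv, getLast?_ne_of_mem_support_reg hxy W hv⟩

end Factorisation

/-! ## 7. Compatibility with `MZV.shuffleReg` on the binary alphabet, and with `NCSeries.exp` -/

section BoolCompat

/-- On `Bool`, `Shuffle.wordSum` is `MZV.wordSum` (definitionally). [folklore] -/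
theorem wordSum_eq_MZV (L : List (List Bool)) : wordSum L = MZV.wordSum L := rfl

/-- On `Bool`, `Shuffle.shuffleSum` is `MZV.shuffleSum` (definitionally). [folklore] -/
theorem shuffleSum_eq_MZV (u v : List Bool) : shuffleSum u v = MZV.shuffleSum u v := rfl

/-- `leadCount true = MZV.leadingY`. [folklore] -/
theorem leadCount_true_eq_leadingY (w : List Bool) : leadCount true w = MZV.leadingY w := by
  unfold leadCount MZV.leadingY
  congr 2
  funext b; cases b <;> rfl

/-- `leadCount false ∘ reverse = MZV.trailingX`. [folklore] -/
theorem leadCount_false_reverse_eq_trailingX (w : List Bool) :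
    leadCount false w.reverse = MZV.trailingX w := by
  unfold leadCount MZV.trailingX
  congr 2
  funext b; cases b <;> rfl

/-- On the binary alphabet the generic front regularisation is `MZV.regFront`. [folklore] -/
theorem regFront_true_eq (w : List Bool) : regFront true w = MZV.regFront w := by
  unfold regFront MZV.regFront
  rw [leadCount_true_eq_leadingY]
  rfl

/-- On the binary alphabet the generic end regularisation is `MZV.regEnd`. [folklore] -/
theorem regEnd_false_eq (w : List Bool) : regEnd false w = MZV.regEnd w := by
  unfold regEnd regFront MZV.regEnd
  rw [leadCount_false_reverse_eq_trailingX, Finsupp.mapDomain_finsetSum]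
  refine Finset.sum_congr rfl fun k _ => ?_
  rw [Finsupp.mapDomain_smul, ← shuffleSum_eq_MZV]
  congr 1
  rw [← shuffleSum_reverse, List.reverse_replicate, List.drop_reverse]
  simp

/-- **On the binary alphabet the generic two-sided regularisation is the tree's `MZV.shuffleReg`**
(`x = false = X₀`, `y = true = X₁`), so that `drinfeldAssociator W = (-1)^{dp W} Z(reg false true
W)`. [cite: IharaKanekoZagier2006, §3 with Cor. 5] -/
theorem reg_false_true_eq_shuffleReg (w : List Bool) : reg false true w = MZV.shuffleReg w := by
  unfold reg MZV.shuffleReg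
  rw [regEnd_false_eq]
  simp only [regFront_true_eq]

end BoolCompat

section ExpCompat
variable [DecidableEq α] {K : Type*} [CommRing K] [Algebra ℚ K]

omit [Algebra ℚ K] in
/-- `(ℓ · c)ⁿ = ℓⁿ · cⁿ`. [folklore] -/
theorem monomial_singleton_pow (c : α) (ℓ : K) :
    ∀ n : ℕ, (NCSeries.monomial [c] ℓ) ^ n = NCSeries.monomial (List.replicate n c) (ℓ ^ n)
  | 0 => by
    ext w; rw [pow_zero, NCSeries.monomial_apply]; cases w <;> simp
  | n + 1 => by
    rw [pow_succ, monomial_singleton_pow c ℓ n, NCSeries.monomial_mul_monomial, ← pow_succ,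
      List.replicate_succ']

/-- `expLetter c ℓ` is the tree's `NCSeries.exp` of the monomial `ℓ · c` (so that
`NCSeries.evalTrunc_exp` applies to it). [folklore] -/
theorem expLetter_eq_exp (c : α) (ℓ : K) : expLetter c ℓ = NCSeries.exp (NCSeries.monomial [c] ℓ) := by
  ext w
  unfold expLetter NCSeries.exp
  simp only [monomial_singleton_pow, NCSeries.monomial_apply]
  split_ifs with h
  · rw [Finset.sum_eq_single_of_mem w.length (by simp) fun m _ hm => ?_]
    · rw [if_pos h]
    · rw [if_neg, mul_zero]
      intro h'
      apply hm
      rw [h', List.length_replicate]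
  · refine (Finset.sum_eq_zero fun m _ => ?_).symm
    rw [if_neg, mul_zero]
    intro h'
    apply h
    have hl : w.length = m := by rw [h', List.length_replicate]
    rw [hl]; exact h'

end ExpCompat

end Shuffle
end Literature.NumberTheory.Transcendental
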